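import Mathlib
import HarnessLib
import HarnessLib.Audit.Tags
import Summits.HodgeConjecture.HodgeConjecture.Theorems.HodgeLocusCensusRamified7BCore

/-!
# HodgeLocusCensusRamified7ThetaBCore — ENGINE B (pub-hlocus abs-2, gen 32): finite core of engine B's modular-forms proof of the
ROW 7 identities ID7a / ID7b / ID7c / C2a / C2b / AB8 (V3-XT N = 1, `ℓ = 7`; kit j131915, j132094; `DERIVATION-R7-B.md` §9.10–§9.11).

HONEST FRAMING: certified instances and evidence bearing on the general Hodge conjecture; no claim.

Engine B proves the identities as identities of modular forms of weight `3/2` with PARI's `mf` package.  The one new mathematical input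
is elementary: Lehman's sign `ε(a + bω)` (`+1` if `7 ∣ b`, `−1` if `7 ∣ a`, for `(N(x), 7) = 1`) equals `[7 ∣ b] − [7 ∣ a]` in all cases,
so by inclusion–exclusion Lehman's weight-one forms are products of unary theta functions `θ_N(z) = θ(Nz)`:
`2g′ = (θ₁ − θ₄)·θ₁₉₆ − (θ₄₉ − θ₁₉₆)·θ₄` and `2h′ = θ₁·θ₉₈ − θ₂·θ₄₉` [cite: Lehman1987, §2 (definitions of g′, h′)].  Only the finite facts
behind that rewriting and the Sturm arithmetic of the certificates are kernel-checked here; the `q`-expansion identities themselves are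
certified by PARI (kit j132094) and are not restated in Lean.

Kernel-checked (no `sorry`, no new axioms; `decide` / `norm_num` / `omega`):
* `eps_eq_indicator_diff` — on `(ℤ/7)²` minus the origin, Lehman's `ε` equals `[b = 0] − [a = 0]`, and at the origin the difference is `0`;
* `odd_and_seven` — `a` odd with `7 ∣ a` iff `a = 7a′` with `a′` odd; `b ≡ 0 (mod 14)` iff `2 ∣ b ∧ 7 ∣ b` (the sublattices behind
  `θ₄₉ − θ₁₉₆` and `θ₁₉₆`), with `49·(2a′+1)² = (14a′+7)²`, `(14b″)² = 196 b″²`, `(7a′)² + 2b² = 49a′² + 2b²`, `a² + 2(7b′)² = a² + 98b′²`;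
* `pairs_factor_two` — the involution `(a,b) ↦ (−a,−b)` has no fixed point with `a` odd (resp. `(a,b) ≠ 0`): Lehman's "pairs `±x`" is the `1/2`;
* `class_projection_characters` — the twist combinations used as class projectors: on odd residues `r mod 8`,
  `1 + χ₋₄(r)·χ₋₄(n) + χ₈(r)·χ₈(n) + χ₋₈(r)·χ₋₈(n) = 4·[n ≡ r]` (table over `(ℤ/8)ˣ`), and `1 ± χ₋₄ = 2·[n ≡ 1], 2·[n ≡ 3]` on odd `n mod 4`;
* `two_mod_four_split` — `n ≡ 2 (mod 4) ↔ 2 ∣ n ∧ ¬ 4 ∣ n` (the part `F₂ = G − G⊗χ₋₄² − B₄U₄G`);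
* `sturm_arithmetic_784_1568_3136` — `784 = 2⁴·7²`, `1568 = 2⁵·7²`, `3136 = 2⁶·7²`; indices `[SL₂(ℤ) : Γ₀(N)] = N·(3/2)·(8/7) = 1344, 2688, 5376`;
  weight-`3/2` Sturm numbers `⌊index·3/24⌋ = 168, 336, 672` (the certificate checks one past each: `169, 337, 673`, and PARI's sharp bounds
  `113, 212, 452` are smaller); twist levels `lcm(784, 4²) = 784`, `lcm(784, 7²) = 784`, `lcm(784, 8²) = 3136`, and `B₄: 392 ↦ 1568`.
-/

namespace Summit.HodgeConjecture.HodgeConjecture.HodgeLocus.Census.Ramified7ThetaBCore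

/-- Lehman's sign versus the indicator difference: for `(a, b) ∈ (ℤ/7)² ∖ {0}`,
`(if b = 0 then 1 else if a = 0 then -1 else 0) = [b = 0] − [a = 0]`, and at `(0,0)` the right-hand side is `0`
(so summing `[7 ∣ b] − [7 ∣ a]` over the full lattice reproduces the sum of `ε` over `(N(x),7) = 1`). -/
theorem eps_eq_indicator_diff :
    (∀ a b : ZMod 7, ¬ (a = 0 ∧ b = 0) →
      ((if b = 0 then 1 else if a = 0 then -1 else 0 : ℤ) = (if b = 0 then 1 else 0) - (if a = 0 then 1 else 0))) ∧
    ((if (0 : ZMod 7) = 0 then 1 else 0 : ℤ) - (if (0 : ZMod 7) = 0 then 1 else 0) = 0) := by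
  refine ⟨by decide, by decide⟩

/-- The sublattices behind the theta products: `a` odd with `7 ∣ a` iff `a = 7a′`, `a′` odd; `14 ∣ b` iff `2 ∣ b ∧ 7 ∣ b`;
and the exponents `(7(2a′+1))² = 49(2a′+1)²`, `(14b″)² = 196b″²`, `(7a′)² + 2b² = 49a′² + 2b²`, `a² + 2(7b′)² = a² + 98b′²`. -/
theorem odd_and_seven :
    (∀ a : ℤ, (a % 2 = 1 ∧ 7 ∣ a) ↔ ∃ a' : ℤ, a = 7 * a' ∧ a' % 2 = 1) ∧
    (∀ b : ℤ, 14 ∣ b ↔ (2 ∣ b ∧ 7 ∣ b)) ∧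
    (∀ a' b'' b a : ℤ, (7 * (2 * a' + 1)) ^ 2 = 49 * (2 * a' + 1) ^ 2 ∧ (14 * b'') ^ 2 = 196 * b'' ^ 2 ∧
        (7 * a') ^ 2 + 2 * b ^ 2 = 49 * a' ^ 2 + 2 * b ^ 2 ∧ a ^ 2 + 2 * (7 * b'') ^ 2 = a ^ 2 + 98 * b'' ^ 2) := by
  refine ⟨fun a => ⟨?_, ?_⟩, fun b => ⟨fun h => ⟨?_, ?_⟩, fun h => ?_⟩, fun a' b'' b a => ⟨by ring, by ring, by ring, by ring⟩⟩
  · rintro ⟨ha, ⟨c, rfl⟩⟩; exact ⟨c, rfl, by omega⟩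
  · rintro ⟨a', rfl, ha'⟩; exact ⟨by omega, ⟨a', rfl⟩⟩
  · obtain ⟨c, rfl⟩ := h; exact ⟨7 * c, by ring⟩
  · obtain ⟨c, rfl⟩ := h; exact ⟨2 * c, by ring⟩
  · obtain ⟨⟨c, hc⟩, ⟨e, he⟩⟩ := h; exact ⟨(b / 14), by omega⟩

/-- "Pairs `±x`": `(a,b) ↦ (−a,−b)` is fixed-point free on `a` odd, and on `(a,b) ≠ (0,0)`; so Lehman's `g′, h′` are half the full lattice sums. -/
theorem pairs_factor_two :
    (∀ a b : ℤ, a % 2 = 1 → (a, b) ≠ (-a, -b)) ∧ (∀ a b : ℤ, (a, b) ≠ (0, 0) → (a, b) ≠ (-a, -b)) := by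
  refine ⟨fun a b ha h => ?_, fun a b h0 h => ?_⟩
  · have := (Prod.mk.injEq _ _ _ _).mp h; omega
  · have := (Prod.mk.injEq _ _ _ _).mp h; apply h0; ext <;> simp <;> omega

/-- Kronecker symbols on odd residues mod 8: `χ₋₄ = (1,-1,1,-1)`, `χ₈ = (1,-1,-1,1)`, `χ₋₈ = (1,1,-1,-1)` at `n = 1,3,5,7`; the class projectors
`1 + χ₋₄(r)χ₋₄(n) + χ₈(r)χ₈(n) + χ₋₈(r)χ₋₈(n) = 4·[n = r]` on `(ℤ/8)ˣ`, and `1 + χ₋₄ = 2·[n ≡ 1 (4)]`, `1 − χ₋₄ = 2·[n ≡ 3 (4)]` on odd `n`. -/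
theorem class_projection_characters :
    let χ4 : Fin 4 → ℤ := ![1, -1, 1, -1]
    let χ8 : Fin 4 → ℤ := ![1, -1, -1, 1]
    let χm8 : Fin 4 → ℤ := ![1, 1, -1, -1]
    (∀ r n : Fin 4, 1 + χ4 r * χ4 n + χ8 r * χ8 n + χm8 r * χm8 n = if n = r then 4 else 0) ∧
    (∀ n : Fin 4, 1 + χ4 n = if n = 0 ∨ n = 2 then 2 else 0) ∧ (∀ n : Fin 4, 1 - χ4 n = if n = 1 ∨ n = 3 then 2 else 0) ∧
    (∀ n : Fin 4, χ4 n * χ8 n = χm8 n) := by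
  refine ⟨by decide, by decide, by decide, by decide⟩

/-- `n ≡ 2 (mod 4)` iff `n` is even and not divisible by `4` (the part `F₂ = G − G⊗χ₋₄² − B₄U₄G` of the ID7b certificate). -/
theorem two_mod_four_split (n : ℤ) : n % 4 = 2 ↔ (2 ∣ n ∧ ¬ 4 ∣ n) := by
  omega

/-- Sturm arithmetic of the certificates (kit j132094 / j131915): levels `784 = 2⁴7²`, `1568 = 2⁵7²`, `3136 = 2⁶7²`, indices
`N·12/7 = 1344, 2688, 5376`, weight-`3/2` Sturm numbers `⌊3·index/24⌋ = 168, 336, 672`; PARI's sharp bounds `113 ≤ 168`, `212 ≤ 336`,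
`452 ≤ 672`; twist levels `lcm(784,16) = 784`, `lcm(784,49) = 784`, `lcm(784,64) = 3136`, `lcm(196,64) = 3136`, and `B₄` raises `392` to `392·4 = 1568`. -/
theorem sturm_arithmetic_784_1568_3136 :
    784 = 2 ^ 4 * 7 ^ 2 ∧ 1568 = 2 ^ 5 * 7 ^ 2 ∧ 3136 = 2 ^ 6 * 7 ^ 2 ∧
    784 * 3 * 8 = 1344 * 2 * 7 ∧ 1568 * 3 * 8 = 2688 * 2 * 7 ∧ 3136 * 3 * 8 = 5376 * 2 * 7 ∧
    1344 * 3 / 24 = 168 ∧ 2688 * 3 / 24 = 336 ∧ 5376 * 3 / 24 = 672 ∧ 113 ≤ 168 ∧ 212 ≤ 336 ∧ 452 ≤ 672 ∧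
    Nat.lcm 784 16 = 784 ∧ Nat.lcm 784 49 = 784 ∧ Nat.lcm 784 64 = 3136 ∧ 392 * 4 = 1568 ∧ Nat.lcm 196 64 = 3136 := by
  refine ⟨by norm_num, by norm_num, by norm_num, by norm_num, by norm_num, by norm_num, by norm_num, by norm_num, by norm_num,
    by norm_num, by norm_num, by norm_num, by decide, by decide, by decide, by norm_num, by decide⟩

end Summit.HodgeConjecture.HodgeConjecture.HodgeLocus.Census.Ramified7ThetaBCore
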